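import Summits.KontsevichZagierPeriods.KontsevichZagierPeriods.Theses.HodgeColevel
import Literature.NumberTheory.Transcendental.KZKernelConjectureForms

/-!
# `DegreeCompression` (stmt-KontsevichZagierPeriods-6177, route HodgeColevel, rank 4) — birth skeleton

Crux (OPEN CORE 1, the compression half of Conjecture 1): if two RATIONAL integral representations
`r` (dimension `n`) and `r'` (dimension `m`) have the same value, then every dimension `k` reachable by
moves from `r` (`∃ s : IntegralRep k, r ~ s`) is reachable from `r'` — equal values ⇒ equal KZ-degree.

Line `birth` ("accessibility, graded by target dimension"). TRANSFER: the crux follows from the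
ONE-representation statement

  `Access_k :  r rational, (∃ u : IntegralRep k, u.value = r.value) → ∃ s : IntegralRep k, r ~ s`

for every `k` — a rational representation can be moved into EVERY dimension in which its value is
representable at all (the dimension is certified by an arbitrary `ℚ`-semialgebraic witness `u`, which need
not be reachable from anything). `DegreeCompression` is `Access` applied to `r'` with the witness `u := s`
(soundness `KZ.Equivalent.value_eq_holds` gives `s.value = r.value = r'.value`); conversely the summit gives
every `Access_k` (semialgebraic two-representation form `kzPeriodConjecture'_iff_isRational`: `r ~ u`), so
the line bets on nothing Conjecture 1 does not already assert (`accessibility_of_summit`, sorry-free below).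
Why the transfer is easier to attack: the second representation disappears, and the statement LOCALISES BY
THE TARGET DIMENSION `k`, each layer owning a different toolbox — the three stubs:

* `stub_pointAccess` (`k = 0`): a rational representation whose value is the value of a point (= a real
  algebraic number, `HurwitzSectorComplement.Negative.isAlgebraic_value_dimZero`; conversely every real
  algebraic `α` is a point value) is KZ-equivalent to a point — Kontsevich–Zagier's own test problem
  ("find an algorithm / accessible proof when a period is algebraic", §1.2 Problem 1 and the remarks after
  Conjecture 1); `n = 1` is Baker's theorem made effective inside the rules (route LowDimension), `n ≥ 2`
  is open.
* `stub_curveAccess` (`k = 1`): a rational representation whose value is a ONE-variable semialgebraic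
  integral (a 1-period: periods of curves relative to points, Huber–Wüstholz) moves to one variable — the
  layer where the linear theory of the values is COMPLETE (HuberWustholz2022 Thm 13.3 / 9.10) and the
  compression `2∫√(1−x²) = ∫ dx/√(1−x²)`-type moves of KZ §1.1 live.
* `stub_higherAccess` (`k ≥ 2`): the same for target dimensions `≥ 2` (values of surface-and-higher
  integrals: `ζ(2) = π²/6`, double zeta values, products of two 1-periods …) — mixed-Tate / MZV territory
  (Brown2012), no complete linear theory of the values; the bulk of the open core.

Composition (sorry-free): `degreeCompression_of_stubs : <stub₀-sig> → <stub₁-sig> → <stub₂-sig> → <crux,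
unfolded verbatim>` by the value transport above and a case split `k = 0 ∣ k = 1 ∣ k ≥ 2`;
`DegreeCompression_of : DegreeCompression` feeds the three stubs in BY NAME (the theorem the skeleton audit
keys on; it admits no inline `Prop` hypotheses, hence the two-theorem shape, as in Cruxes/CTConstruction,
Cruxes/BetaProductSector). Disproof used: none on file (no `Disproof.lean`, no dead lines, no crux ideas for
6177; `ledger negatives` has one unrelated entry). Negative lemmas checked: the stubs do not mention
`KZ.degree = hodgeColevel` and are not instances of `DegreeEquality.Negative.not_typedReading` /
`…ZeroLayer` (those bite the TYPED reading of the sister crux DegreeEquality at the zero symbol); at a null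
rational representation (`[r] ∈ relations`, value `0`) `stub_pointAccess` asks `r ~` a point, which holds
(`r ~ IntegralRep.empty 0`), so the zero edge does not bite here.
-/

set_option linter.dupNamespace false

noncomputable section

namespace Summit.KontsevichZagierPeriods.KontsevichZagierPeriods.Cruxes.DegreeCompression.Birth

open Summit.KontsevichZagierPeriods.KontsevichZagierPeriods.Theses.HodgeColevel (DegreeCompression)

/-! ## The three stubs (accessibility by target dimension) -/

/-- Stub 0 — POINT ACCESSIBILITY (`k = 0`; the algebraic-value layer). A representation of KZ's literal
(rational) shape whose value is also the value of some `0`-dimensional representation (equivalently: whose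
value is a real algebraic number) is KZ-equivalent to a `0`-dimensional representation. Why plausibly true:
it is Conjecture 1 for algebraic periods (summit ⇒ stub, `accessibility_of_summit`); `n ≤ 1` is the
Baker sector of route LowDimension. Why it might fail: an `n ≥ 2` rational integral with algebraic value
and no accessible proof (KZ §1.2: not even an algorithm is known). Sources: KontsevichZagier2001 §1.2
(Conjecture 1, Problem 1), Baker1975, HuberWustholz2022. Size: open problem (XL). -/
theorem stub_pointAccess : ∀ (n : ℕ) (r : Literature.NumberTheory.Transcendental.KZ.IntegralRep n), r.IsRational → (∃ u : Literature.NumberTheory.Transcendental.KZ.IntegralRep 0, u.value = r.value) → ∃ s : Literature.NumberTheory.Transcendental.KZ.IntegralRep 0, Literature.NumberTheory.Transcendental.KZ.Equivalent r s := by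
  sorry

/-- Stub 1 — CURVE ACCESSIBILITY (`k = 1`; the 1-period layer). A representation of KZ's literal shape
whose value is the value of some `1`-dimensional (`ℚ`-semialgebraic) representation — a 1-period in the
sense of Huber–Wüstholz — is KZ-equivalent to a `1`-dimensional representation. Why plausibly true: summit ⇒
stub; the values form the one sector whose `ℚ̄`-linear relations are completely classified
(HuberWustholz2022 Thm 13.3), and KZ's model compressions (`π` as a disc area → `∫ dx/(1+x²)`) are of this
type. Why it might fail: a rational double integral equal to an elliptic or logarithmic 1-period with no
chain of moves down to one variable (excursion/primitive obstructions of the kind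
`Literature.Barriers.KontsevichZagierPeriods.noSemialgebraicPrimitive_inv_sub_two`). Sources:
KontsevichZagier2001 §1.1–1.2, HuberWustholz2022 Thm 9.10 / 13.3, HuberMullerStachPeriods2017 Ch. 12.
Size: open problem (XL). -/
theorem stub_curveAccess : ∀ (n : ℕ) (r : Literature.NumberTheory.Transcendental.KZ.IntegralRep n), r.IsRational → (∃ u : Literature.NumberTheory.Transcendental.KZ.IntegralRep 1, u.value = r.value) → ∃ s : Literature.NumberTheory.Transcendental.KZ.IntegralRep 1, Literature.NumberTheory.Transcendental.KZ.Equivalent r s := by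
  sorry

/-- Stub 2 — HIGHER ACCESSIBILITY (`k ≥ 2`). A representation of KZ's literal shape whose value is the
value of some `k`-dimensional representation, `k ≥ 2`, is KZ-equivalent to a `k`-dimensional
representation. Why plausibly true: summit ⇒ stub; the known accessible identities of this layer
(`ζ(2) = π²/6` à la Beukers–Kolk–Calabi, shuffle/stuffle products of MZV simplices) are compressions of
exactly this kind. Why it might fail: it carries the bulk of open core 1 — e.g. a rational `3`-fold integral
equal to a double zeta value with no chain to two variables; mixed-Tate weight bookkeeping (Brown2012) only
predicts, never constructs, the chain. Sources: KontsevichZagier2001 §1.2 Problem 2, Brown2012,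
Wan2011 §3, HuberMullerStachPeriods2017 Ch. 13. Size: open problem (XL). -/
theorem stub_higherAccess : ∀ (k : ℕ), 2 ≤ k → ∀ (n : ℕ) (r : Literature.NumberTheory.Transcendental.KZ.IntegralRep n), r.IsRational → (∃ u : Literature.NumberTheory.Transcendental.KZ.IntegralRep k, u.value = r.value) → ∃ s : Literature.NumberTheory.Transcendental.KZ.IntegralRep k, Literature.NumberTheory.Transcendental.KZ.Equivalent r s := by
  sorry

/-! ## Glue (sorry-free) -/

open Literature.NumberTheory.Transcendental

/-- The composition, arrow form: POINT → CURVE → HIGHER accessibility → the crux (UNFOLDED verbatim, so that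
exactly one theorem of this file, `DegreeCompression_of`, concludes the crux by name). The witness `s`
reached from `r` certifies, by soundness of the moves (`KZ.Equivalent.value_eq_holds`), that the common value
of `r` and `r'` is representable in dimension `k`; accessibility of `r'` at `k` is the stub of the layer of
`k`. [cite: KontsevichZagier2001, §1.2 Conjecture 1] -/
theorem degreeCompression_of_stubs
    (h0 : ∀ (n : ℕ) (r : KZ.IntegralRep n), r.IsRational → (∃ u : KZ.IntegralRep 0, u.value = r.value) →
      ∃ s : KZ.IntegralRep 0, KZ.Equivalent r s)
    (h1 : ∀ (n : ℕ) (r : KZ.IntegralRep n), r.IsRational → (∃ u : KZ.IntegralRep 1, u.value = r.value) →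
      ∃ s : KZ.IntegralRep 1, KZ.Equivalent r s)
    (h2 : ∀ (k : ℕ), 2 ≤ k → ∀ (n : ℕ) (r : KZ.IntegralRep n), r.IsRational →
      (∃ u : KZ.IntegralRep k, u.value = r.value) → ∃ s : KZ.IntegralRep k, KZ.Equivalent r s) :
    ∀ ⦃n m : ℕ⦄ (r : Literature.NumberTheory.Transcendental.KZ.IntegralRep n) (r' : Literature.NumberTheory.Transcendental.KZ.IntegralRep m), r.IsRational → r'.IsRational → r.value = r'.value → ∀ (k : ℕ), (∃ s : Literature.NumberTheory.Transcendental.KZ.IntegralRep k, Literature.NumberTheory.Transcendental.KZ.Equivalent r s) → ∃ s' : Literature.NumberTheory.Transcendental.KZ.IntegralRep k, Literature.NumberTheory.Transcendental.KZ.Equivalent r' s' := by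
  intro n m r r' _ hr' hv k hs
  obtain ⟨s, hs⟩ := hs
  -- the dimension `k` is certified for the common value by the witness `s`
  have hu : ∃ u : KZ.IntegralRep k, u.value = r'.value :=
    ⟨s, ((KZ.Equivalent.value_eq_holds hs).symm).trans hv⟩
  -- accessibility of `r'` at `k`, by layer
  rcases Nat.lt_or_ge k 2 with hk | hk
  · interval_cases k
    · exact h0 m r' hr' hu
    · exact h1 m r' hr' hu
  · exact h2 k hk m r' hr' hu

/-- **The skeleton theorem** (concludes the crux BY NAME; sorries enter only through the three named stubs):
`DegreeCompression` from POINT, CURVE and HIGHER accessibility. [cite: KontsevichZagier2001, §1.2 Conjecture 1] -/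
theorem DegreeCompression_of : DegreeCompression :=
  degreeCompression_of_stubs stub_pointAccess stub_curveAccess stub_higherAccess

/-! ## Consistency (sorry-free): the summit implies every layer of accessibility -/

/-- The summit `KontsevichZagierPeriods` implies accessibility at EVERY target dimension, hence each of the
three stubs: by the semialgebraic two-representation form of Conjecture 1
(`kzPeriodConjecture'_iff_isRational`) a rational `r` and any witness `u` of the same value are themselves
KZ-equivalent. So the line assumes nothing beyond Conjecture 1. [cite: KontsevichZagier2001, §1.2 Conjecture 1] -/
theorem accessibility_of_summit (H : _root_.KontsevichZagierPeriods) :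
    ∀ (k n : ℕ) (r : KZ.IntegralRep n), r.IsRational → (∃ u : KZ.IntegralRep k, u.value = r.value) →
      ∃ s : KZ.IntegralRep k, KZ.Equivalent r s := by
  intro k n r _ hu
  obtain ⟨u, hu⟩ := hu
  have H' : KZPeriodConjecture' := kzPeriodConjecture'_iff_isRational.mpr H
  exact ⟨u, H' r u hu.symm⟩

end Summit.KontsevichZagierPeriods.KontsevichZagierPeriods.Cruxes.DegreeCompression.Birth

end
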